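import Literature.MathematicalPhysics.QuantumFieldTheory.Balaban1983to89.B5G183FreeRowSum

/-!
# B5 Proposition 1.2, (1.110): the FOUR localized sup entries «|(GJ)(x)|, |(∇GJ)(x)|, |(G∇*J)(x)|, |(ΔGJ)(x)|
# ≤ O(1)e^{−δ₀|y−y′|}|J|» as CONCRETE named statements for the torus matrix `G = Δ_a⁻¹ = (DeltaA n M a)⁻¹`
# (U = 1), uniform in `n = L^k` and in the torus — STATEMENT LEVEL (interfaces), plus the first entry DISCHARGED
# at `a = 1` from the tree

Source: T. Bałaban, *Propagators and renormalization transformations for lattice gauge theories. I*, Commun. Math.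
Phys. **95** (1984) 17–40 (`Balaban1984PropagatorsI`, cell paper B5), Sect. F, Proposition 1.2, p. 35 [PDF 19], as quoted
verbatim in the tree headers of `B5G183FreeRowSum` / `B5G115SupBound` (renders `…-p019-x2.png`, `…-p020-x2.png` read there):
«There exists a positive constant δ₀ depending on d only, such that |(GJ)(x)|, |(∇GJ)(x)|, |(G∇*J)(x)|, |(ΔGJ)(x)| ≤
O(1)e^{−δ₀|y−y′|}|J| (1.110) for x ∈ Δ̃(y), supp J ⊂ Δ̃(y′), with the constant O(1) depending on d only,»; p. 35 (1.108):
«|A| = max_μ sup_x |A_μ(x)|,»; p. 35: «Cubes Δ(y) are simply unit cubes of T_η, or Δ(y) = B^k(y), y ∈ T₁^{(k)}.»; p. 30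
(1.71): «Δ_a⁻¹ = G_k, or simply G» (typed: `B5DeltaA169.DeltaA n M a = Δ − ∂P∂* + aQ*Q`).

WHY THIS FILE — it is the STATEMENT-LEVEL answer to the crux prover's **INTERFACE REQUEST G-an2-4: (B5-1115-TABLE)** (road-P2 owner
b2b-balaban-gan24-p2 gen 28, `HOME/INBOX.md` block 2026-08-21T05:44Z, journal `CLAIMS.log` l.27856; memo `HOME/b2b-balaban-gan24-p2/gen28/ROUTE-AUDIT-P2.md`
§4): «for `G := (B5DeltaA169.DeltaA n M a)⁻¹` at U = 1, constants depending on `d`, `a` only — uniform in `n = L^k` and in the torus: (E2)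
`∀ x ∈ B(y), supp J ⊆ B(y′): |(∇_ν G J)(x)| ≤ C·e^{−δ|y−y′|_∞}·|J|` (the shape of pv15's `B5G183FreeRowSum.norm_DeltaA_one_inv_mulVec_le_uniform`
with `∇_νG` in place of `G`); (E3) the same for `G∇_ν*J`; (E4) the same for `ΔGJ`; …».  Consumers named there: ROUTES-GAN24 R1-S6 (sup form),
R2-S3∕S3′, NE2 (R9.iii) position-space decay, road P2's parked L27-3.  (E2) = `Entry110Grad`, (E3) = `Entry110GDiv`, (E4) = `Entry110Lap`
below, typed as NAMED STATEMENTS a consumer binds as hypotheses and a prover discharges in its own file; (H) (Hölder entries) and (D) (the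
D4-lane `levelOp` dictionary) of the request are NOT in this file.  The tree types Prop. 1.2 over an ABSTRACT carrier
(`B5.Prop12Printed`, `B5.Setting`) and proves the FIRST entry concretely (`B5G183FreeRowSum.norm_DeltaA_one_inv_mulVec_le_uniform`,
localized; `B5G115SupBound.norm_DeltaA_one_inv_mulVec_le_global`, (1.115)).  THIS FILE states the four entries of (1.110) ONE BY
ONE for the CONCRETE matrices, in exactly the currency of the landed first entry — `x = bpt n M (toT M y) r` a site of the unit
cube `B(y)`, `supp J ⊂ B(y′)`, `|J| ≤ B`, distance `|y − y′|_∞ = torusSupNorm M (y − y′)` on `T₁ = Π_μ ℤ/M_μ`, `∇_ν = fdiff (fine n M) n ν`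
(lattice factor `n = η⁻¹`), `∇_ν^* = (fdiff …)ᴴ`, `Δ = B5Prop11Lower.Lap n M` — so that a consumer (R2-S3) can take
`(h : Entry110Grad d a)` etc. as a NAMED printed hypothesis, and a prover can discharge each entry in its own file.

## Contents
* `Entry110G`, `Entry110Grad`, `Entry110GDiv`, `Entry110Lap` : `ℕ → ℝ → Prop` — the four entries of (1.110) for
  `G = (DeltaA n M a)⁻¹`, quantifier order as printed (`δ₀`, `O(1)` chosen before the instance `(n, M)`; they depend on
  `d` and on the fixed `a`).  [cite: Balaban1984PropagatorsI, Prop. 1.2 (1.110) p.35]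
* `entry110G_one : Entry110G d 1` — the FIRST entry DISCHARGED at `a = 1` from `B5G183FreeRowSum` BY NAME (the two printed-shape
  rates merged into one `δ₀ = min(1/(2(d+1)), κ₁₈₃(d+1)/(d+1))`; constant ours).

HONEST SCOPE.  (i) Unit cubes `Δ = B` in place of the printed doubled cubes `Δ̃` on both sides (as in the landed first entry; the
passage costs a factor `2^{d+1}e^{δ₀}` by splitting `J` over the `2^{d+1}` unit cubes of `Δ̃(y′)`, not typed).  (ii) `(d+1)`-dimensional
index bookkeeping (`Fin (d+1)` directions) of the `B5G183*` files.  (iii) `Entry110Grad`, `Entry110GDiv`, `Entry110Lap` are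
STATEMENTS ONLY — interfaces for R2-S3; NOT proved here, for any `a`; (1.111)–(1.114) (Hölder and L² entries) are NOT typed here.
(iv) Nothing of B5 is used as a hypothesis anywhere in this file; `entry110G_one` is kernel-proved from the tree.
CITATION HEADER (cell ABSOLUTE RULE): «No internally-minted statement may enter as a cited fact. Every hypothesis is either
kernel-proved in this package or a verbatim quotation of a PUBLISHED theorem with page reference.»  The four `def`s are verbatim
concrete readings of the printed (1.110); they are named facts, to be discharged, never cited as proved.  Unit
`b2b-balaban-gan24-formalise-leaf-01` (G-an2-4 swarm leaf 01, gen 53), filed on the crux prover's INTERFACE REQUEST G-an2-4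
(B5-1115-TABLE) — the freeze's channel (coordinator ruling e34b3e0c (0)).  NOT (CONV-C), NOT D1, NOT BetaPertH, NOT continuum, NOT Clay.  HONEST DEPENDENCY: continuum YM on T⁴ ⇐
BetaPertH ∧ nine spine estimates (0/9 proved); BetaPertH ⇐ (D1) ∧ (D4) ∧ CAP+tail; G-an2-4 gates asym, D1 and NE2/3/4.
-/

open scoped BigOperators Matrix ComplexConjugate Real
open Finset Complex Matrix

namespace Literature.MathematicalPhysics.QuantumFieldTheory.Balaban1983to89.B5Prop12Entries110

open Literature.MathematicalPhysics.QuantumFieldTheory.Balaban1983to89.B5Prop11Plancherel (Tor fine fdiff)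
open Literature.MathematicalPhysics.QuantumFieldTheory.Balaban1983to89.B5Prop11Lower (Lap)
open Literature.MathematicalPhysics.QuantumFieldTheory.Balaban1983to89.B4TorusKernel (periodConst)
open Literature.MathematicalPhysics.QuantumFieldTheory.Balaban1983to89.B4TorusKernel.MultiPeriod (torusSupNorm torusSupNorm_nonneg)
open Literature.MathematicalPhysics.QuantumFieldTheory.Balaban1983to89.B5Block118 (bpt)
open Literature.MathematicalPhysics.QuantumFieldTheory.Balaban1983to89.B5DeltaA169 (DeltaA)
open Literature.MathematicalPhysics.QuantumFieldTheory.Balaban1983to89.B5G183Strip (kappa183 kappa183_pos)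
open Literature.MathematicalPhysics.QuantumFieldTheory.Balaban1983to89.B5G183CovDecay (MD183 MD183_nonneg)
open Literature.MathematicalPhysics.QuantumFieldTheory.Balaban1983to89.B5Kernel166Decay (periodConst_pos)
open Literature.MathematicalPhysics.QuantumFieldTheory.Balaban1983to89.B6LowerBound2153Torus (toT)
open Literature.MathematicalPhysics.QuantumFieldTheory.Balaban1983to89.B6Cov2156Torus (one_le_M)
open Literature.MathematicalPhysics.QuantumFieldTheory.Balaban1983to89.B5G183FreeRowSum (norm_DeltaA_one_inv_mulVec_le_uniform)

noncomputable section

variable (d : ℕ) (a : ℝ)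

/-- **(1.110), FIRST ENTRY «|(GJ)(x)| ≤ O(1)e^{−δ₀|y−y′|}|J|»** for `G = (DeltaA n M a)⁻¹`, concretely: there are `δ₀ > 0`,
`C > 0` (depending on `d` and the fixed `a` only) such that for every `n ≥ 1`, every torus `M`, every `y, y′ ∈ ℤ^{d+1}`, every
field `J` supported in the unit cube `B(y′)` with `|J| ≤ B`, every site `x = n·y + r` of `B(y)` and every component `μ`:
`|(GJ)_μ(x)| ≤ C·e^{−δ₀|y−y′|_∞}·B`.  (Unit cubes in place of the printed `Δ̃`; see HONEST SCOPE (i).)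
[cite: Balaban1984PropagatorsI, Prop. 1.2 (1.110) p.35] -/
def Entry110G : Prop :=
  ∃ δ₀ C : ℝ, 0 < δ₀ ∧ 0 < C ∧
    ∀ (n : ℕ) (M : Fin (d + 1) → ℕ) [NeZero n] [∀ μ, NeZero (M μ)], 1 ≤ n →
      ∀ (y y' : Fin (d + 1) → ℤ) (J : Tor (fine n M) × Fin (d + 1) → ℂ) (B : ℝ),
        (∀ j, ‖J j‖ ≤ B) → (∀ j, J j ≠ 0 → ∃ r' : Fin (d + 1) → Fin n, j.1 = bpt n M (toT M y') r') →
        ∀ (r : Fin (d + 1) → Fin n) (μ : Fin (d + 1)),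
          ‖((DeltaA n M a)⁻¹ *ᵥ J) (bpt n M (toT M y) r, μ)‖ ≤ C * Real.exp (-(δ₀ * torusSupNorm M (y - y'))) * B

/-- **(1.110), SECOND ENTRY «|(∇GJ)(x)| ≤ O(1)e^{−δ₀|y−y′|}|J|»**, `∇ = ∇_ν = fdiff (fine n M) n ν` the `η`-lattice forward
difference (factor `n = η⁻¹`), every direction `ν`, acting componentwise on `GJ`; same letters as the first entry.
[cite: Balaban1984PropagatorsI, Prop. 1.2 (1.110) p.35] -/
def Entry110Grad : Prop :=
  ∃ δ₀ C : ℝ, 0 < δ₀ ∧ 0 < C ∧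
    ∀ (n : ℕ) (M : Fin (d + 1) → ℕ) [NeZero n] [∀ μ, NeZero (M μ)], 1 ≤ n →
      ∀ (ν : Fin (d + 1)) (y y' : Fin (d + 1) → ℤ) (J : Tor (fine n M) × Fin (d + 1) → ℂ) (B : ℝ),
        (∀ j, ‖J j‖ ≤ B) → (∀ j, J j ≠ 0 → ∃ r' : Fin (d + 1) → Fin n, j.1 = bpt n M (toT M y') r') →
        ∀ (r : Fin (d + 1) → Fin n) (μ : Fin (d + 1)),
          ‖(fdiff (fine n M) (n : ℂ) ν *ᵥ ((DeltaA n M a)⁻¹ *ᵥ J)) (bpt n M (toT M y) r, μ)‖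
            ≤ C * Real.exp (-(δ₀ * torusSupNorm M (y - y'))) * B

/-- **(1.110), THIRD ENTRY «|(G∇*J)(x)| ≤ O(1)e^{−δ₀|y−y′|}|J|»**, `∇* = ∇_ν^* = (fdiff (fine n M) n ν)ᴴ` the adjoint difference
(divergence component), every direction `ν`; same letters as the first entry. [cite: Balaban1984PropagatorsI, Prop. 1.2 (1.110) p.35] -/
def Entry110GDiv : Prop :=
  ∃ δ₀ C : ℝ, 0 < δ₀ ∧ 0 < C ∧
    ∀ (n : ℕ) (M : Fin (d + 1) → ℕ) [NeZero n] [∀ μ, NeZero (M μ)], 1 ≤ n →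
      ∀ (ν : Fin (d + 1)) (y y' : Fin (d + 1) → ℤ) (J : Tor (fine n M) × Fin (d + 1) → ℂ) (B : ℝ),
        (∀ j, ‖J j‖ ≤ B) → (∀ j, J j ≠ 0 → ∃ r' : Fin (d + 1) → Fin n, j.1 = bpt n M (toT M y') r') →
        ∀ (r : Fin (d + 1) → Fin n) (μ : Fin (d + 1)),
          ‖((DeltaA n M a)⁻¹ *ᵥ ((fdiff (fine n M) (n : ℂ) ν)ᴴ *ᵥ J)) (bpt n M (toT M y) r, μ)‖
            ≤ C * Real.exp (-(δ₀ * torusSupNorm M (y - y'))) * B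

/-- **(1.110), FOURTH ENTRY «|(ΔGJ)(x)| ≤ O(1)e^{−δ₀|y−y′|}|J|»**, `Δ = B5Prop11Lower.Lap n M = Σ_ν ∇_ν^*∇_ν` the `η`-lattice Laplace
operator acting componentwise; same letters as the first entry. [cite: Balaban1984PropagatorsI, Prop. 1.2 (1.110) p.35] -/
def Entry110Lap : Prop :=
  ∃ δ₀ C : ℝ, 0 < δ₀ ∧ 0 < C ∧
    ∀ (n : ℕ) (M : Fin (d + 1) → ℕ) [NeZero n] [∀ μ, NeZero (M μ)], 1 ≤ n →
      ∀ (y y' : Fin (d + 1) → ℤ) (J : Tor (fine n M) × Fin (d + 1) → ℂ) (B : ℝ),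
        (∀ j, ‖J j‖ ≤ B) → (∀ j, J j ≠ 0 → ∃ r' : Fin (d + 1) → Fin n, j.1 = bpt n M (toT M y') r') →
        ∀ (r : Fin (d + 1) → Fin n) (μ : Fin (d + 1)),
          ‖(Lap n M *ᵥ ((DeltaA n M a)⁻¹ *ᵥ J)) (bpt n M (toT M y) r, μ)‖
            ≤ C * Real.exp (-(δ₀ * torusSupNorm M (y - y'))) * B

/-- **the FIRST ENTRY of (1.110) HOLDS at `a = 1`** for the concrete `G = (DeltaA n M 1)⁻¹`, uniformly in `n` and in the torus:
`B5G183FreeRowSum.norm_DeltaA_one_inv_mulVec_le_uniform` BY NAME (splitting order `N = d`), its two rates `1/(2(d+1))` and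
`κ₁₈₃(d+1)/(d+1)` merged into `δ₀ = min` and its two constants summed (+1).
[cite: Balaban1984PropagatorsI, Prop. 1.2 (1.110) p.35 (first entry; kernel version, constants and proof ours)] -/
theorem entry110G_one : Entry110G d 1 := by
  set δ₁ : ℝ := 1 / (2 * (d + 1)) with hδ₁
  set δ₂ : ℝ := kappa183 (d + 1) / (d + 1) with hδ₂
  set C₁ : ℝ := 2 * d * 2 ^ d * Real.exp (1 / (2 * (d + 1))) with hC₁
  set C₂ : ℝ := (d + 1) * (MD183 (d + 1) d * periodConst (kappa183 (d + 1)) d) with hC₂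
  have hδ₁0 : 0 < δ₁ := by positivity
  have hδ₂0 : 0 < δ₂ := div_pos (kappa183_pos _) (by positivity)
  have hC₁0 : 0 ≤ C₁ := by positivity
  have hC₂0 : 0 ≤ C₂ := by
    have h1 := MD183_nonneg (d + 1) d
    have h2 := (periodConst_pos (kappa183_pos (d + 1)) d).le
    positivity
  refine ⟨min δ₁ δ₂, C₁ + C₂ + 1, lt_min hδ₁0 hδ₂0, by positivity, ?_⟩
  intro n M _ _ hn y y' J B hJB hsupp r μ
  have h := norm_DeltaA_one_inv_mulVec_le_uniform n hn M (Nn := d) le_rfl y y' J hJB hsupp r μ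
  have hB0 : 0 ≤ B := (norm_nonneg _).trans (hJB (bpt n M (toT M y) r, μ))
  have hT : 0 ≤ torusSupNorm M (y - y') := torusSupNorm_nonneg (one_le_M M) _
  set E : ℝ := Real.exp (-(min δ₁ δ₂ * torusSupNorm M (y - y'))) with hE
  have hE0 : 0 ≤ E := (Real.exp_pos _).le
  have e1 : Real.exp (-(1 / (2 * (d + 1)) * torusSupNorm M (y - y'))) ≤ E := by
    rw [hE, ← hδ₁]; apply Real.exp_le_exp.mpr
    have := min_le_left δ₁ δ₂; nlinarith
  have e2 : Real.exp (-(kappa183 (d + 1) / (d + 1) * torusSupNorm M (y - y'))) ≤ E := by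
    rw [hE, ← hδ₂]; apply Real.exp_le_exp.mpr
    have := min_le_right δ₁ δ₂; nlinarith
  calc ‖((DeltaA n M 1)⁻¹ *ᵥ J) (bpt n M (toT M y) r, μ)‖
      ≤ B * (C₁ * Real.exp (-(1 / (2 * (d + 1)) * torusSupNorm M (y - y')))
          + (d + 1) * (MD183 (d + 1) d * periodConst (kappa183 (d + 1)) d
              * Real.exp (-(kappa183 (d + 1) / (d + 1) * torusSupNorm M (y - y'))))) := by
        simpa [hC₁] using h
    _ ≤ B * (C₁ * E + C₂ * E) := by
        rw [hC₂]
        have h2 : (d + 1 : ℝ) * (MD183 (d + 1) d * periodConst (kappa183 (d + 1)) d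
              * Real.exp (-(kappa183 (d + 1) / (d + 1) * torusSupNorm M (y - y'))))
            ≤ (d + 1) * (MD183 (d + 1) d * periodConst (kappa183 (d + 1)) d) * E := by
          rw [mul_assoc ((d : ℝ) + 1)]
          have hmp : 0 ≤ (d + 1 : ℝ) * (MD183 (d + 1) d * periodConst (kappa183 (d + 1)) d) := hC₂0
          have : 0 ≤ MD183 (d + 1) d * periodConst (kappa183 (d + 1)) d :=
            mul_nonneg (MD183_nonneg _ _) (periodConst_pos (kappa183_pos _) _).le
          nlinarith [e2, this]
        have h1 : C₁ * Real.exp (-(1 / (2 * (d + 1)) * torusSupNorm M (y - y'))) ≤ C₁ * E :=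
          mul_le_mul_of_nonneg_left e1 hC₁0
        exact mul_le_mul_of_nonneg_left (add_le_add h1 h2) hB0
    _ ≤ (C₁ + C₂ + 1) * E * B := by nlinarith [mul_nonneg hE0 hB0]

end

end Literature.MathematicalPhysics.QuantumFieldTheory.Balaban1983to89.B5Prop12Entries110
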